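import Summits.QuantumFields.YangMills.Theorems.UnitScaleTiltProp7TwoWordStokes
import Summits.QuantumFields.YangMills.Theorems.UnitScaleTiltProp7CovIterLambdaBound
import Summits.QuantumFields.YangMills.Theorems.UnitScaleTiltProp7LineOfTransportedFamily
import Literature.MathematicalPhysics.QuantumFieldTheory.Balaban1983to89.BlockAveragingEMLProp2
import HarnessLib

/-!
# Route `UnitScaleTilt`, crux K1 «MinimiserStabilityRegPr» (stmt-QuantumFields-19200), route-R [RP] at a curved background — THE CURVED N6,
# ROW (R-B), PART 6b (second piece of FILE 3, the one-step gradient transfer): THE COVARIANT GRADIENT OF THE STRAIGHT LINE SUM — covariant telescoping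
# along a transverse line, and the transverse covariant derivative of the line-sum function `f(x) = Z_V([x → L steps e_μ])` bounded by the line sum of the
# transverse covariant derivatives of `Z` plus a ladder-loop defect `2L²δ` per term

Cell `ym3-torus`, D-0154 (3c) R3 twin-width seat `ym-routeR-w2` (W-SEAT MAP pass #3 row M9; architecture «ℓ²-Minkowski over levels, level-local», ★★OWNER g26
ACK 12).  THEOREMS ONLY (0 `def`, 0 `sorry`); `--supports stmt-QuantumFields-19200`, count-neutral.  YM₃ on T³ is a ladder rung (R3), not the Clay problem; nothing here
claims the curved N6 bound, S2, P, the crux or the gap.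

WHY.  The displayed row (hgrad) of `Prop7CovIterLambdaEnergy.sum_normSq_covIterLambda_le` needs `‖∇^{(j+1)}LINE_j(X)‖_{ℓ²} ≤ L^{(4−d)/2}‖∇^{(j)}X‖_{ℓ²} + …`.  After
the two frames of the neighbouring coarse bonds are matched (part 6c, `Prop7TwoWordStokes.norm_conj_holAt_sub_conj_holAt_le`), the covariant difference of the line sums
`T·f(x + Le_ν)·T* − f(x)` (`T = V([x → L steps e_ν])`) telescopes EXACTLY into `Σ_{s<L} Ad_{V([x→s e_ν])}(∇^V_ν f)(x + se_ν)` (§1), and `(∇^V_ν f)(x)` is the line sum of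
`Ad_{V([x→t e_μ])}(∇^V_ν Z)(x + te_μ, μ)` up to the difference of the two transports «`e_ν` then `t·e_μ`» vs «`t·e_μ` then `e_ν`» — a closed word of length
`2t + 2`, within `(t+1)²δ` of `1` (§2).
* §1 `conj_line_telescope` (identity), `norm_conj_line_sub_le` (`‖T f(x+Le_ν) T* − f(x)‖ ≤ Σ_{s<L} ‖(∇^V_ν f)(x+se_ν)‖`).
* §2 ★★ `norm_covGrad_lineSum_le` — `‖(∇^V_ν f)(x)‖ ≤ Σ_{t<L} ‖(∇^V_ν Z)(x+te_μ, μ)‖ + 2L²δ·Σ_{t<L} ‖Z(x+e_ν+te_μ, μ)‖` under `PlaqSmall δ V`.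
HONEST SCOPE.  Pointwise algebra + the tree's two-word Stokes bound; the frame matching (6c) and the `ℓ²` count (6a ✓∕⧗ `…CovLineGradCount`) are separate files.

References: T. Bałaban, CMP 99 (1985) 75–102 [Balaban1985RegularSpaces] ((1.1) p.76); CMP 98 (1985) 17–51 [Balaban1985Averaging] ((19)–(20) p.21, (58) p.27);
CMP 95 (1984) 17–40 [Balaban1984PropagatorsI] ((1.18) p.20).
-/

noncomputable section

open scoped BigOperators Matrix.Norms.L2Operator

namespace Summit.QuantumFields.YangMills.Theorems.Prop7CovLineGradPointwise

open Literature.MathematicalPhysics.QuantumFieldTheory.Balaban1983to89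
open Finset T4Continuum BlockAveraging AveragingRT BlockAveragingEMLLinearised BlockAveragingEMLLinearisedBackground BlockAveragingEMLProp2
open Summit.QuantumFields.YangMills.Theorems.Prop7LineOfTransportedFamily (holAt_walk_replicate_succ covWalkSum_walk_replicate_true)
open Summit.QuantumFields.YangMills.Theorems.Prop7TwoWordStokes (norm_conj_holAt_sub_conj_holAt_le)
open Summit.QuantumFields.YangMills.Theorems.Prop7CovIterLambdaBound (norm_conj_su_le)

variable {P : Params} {n : Type*} [Fintype n] [DecidableEq n] [Nonempty n] {j : ℕ}

/-! ## §1 Covariant telescoping along a straight transverse line -/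

/-- **COVARIANT TELESCOPING OF A SITE FUNCTION ALONG `m` STEPS `e_ν`**: with `T_s = V([x → s steps e_ν])`, `x_s = x + se_ν`,
`T_m·f(x_m)·T_m* − f(x) = Σ_{s<m} T_s·(V(x_s,ν)f(x_{s+1})V(x_s,ν)* − f(x_s))·T_s*`. [cite: Balaban1985RegularSpaces, (1.1) p.76] -/
theorem conj_line_telescope (V : GaugeField P j (Matrix.specialUnitaryGroup n ℂ)) (f : Site P j → Matrix n n ℂ) (ν : Fin P.d) :
    ∀ (m : ℕ) (x : Site P j),
      ((holAt V (walk x (List.replicate m (ν, true))) : Matrix.specialUnitaryGroup n ℂ) : Matrix n n ℂ) * f ((fun z : Site P j => z.shift ν)^[m] x)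
          * star ((holAt V (walk x (List.replicate m (ν, true))) : Matrix.specialUnitaryGroup n ℂ) : Matrix n n ℂ) - f x
        = ∑ s ∈ range m,
          ((holAt V (walk x (List.replicate s (ν, true))) : Matrix.specialUnitaryGroup n ℂ) : Matrix n n ℂ)
            * (((V ⟨(fun z : Site P j => z.shift ν)^[s] x, ν⟩ : Matrix.specialUnitaryGroup n ℂ) : Matrix n n ℂ)
                * f ((fun z : Site P j => z.shift ν)^[s + 1] x)
                * star ((V ⟨(fun z : Site P j => z.shift ν)^[s] x, ν⟩ : Matrix.specialUnitaryGroup n ℂ) : Matrix n n ℂ)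
              - f ((fun z : Site P j => z.shift ν)^[s] x))
            * star ((holAt V (walk x (List.replicate s (ν, true))) : Matrix.specialUnitaryGroup n ℂ) : Matrix n n ℂ)
  | 0, x => by simp [walk, holAt_nil]
  | m + 1, x => by
    rw [Finset.sum_range_succ', holAt_walk_replicate_succ, Submonoid.coe_mul, star_mul]
    have ih := conj_line_telescope V f ν m (x.shift ν)
    -- the `s + 1` terms: prefix transports factor through `V(x,ν)`
    have hterm : ∀ s ∈ range m,
        ((holAt V (walk x (List.replicate (s + 1) (ν, true))) : Matrix.specialUnitaryGroup n ℂ) : Matrix n n ℂ)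
            * (((V ⟨(fun z : Site P j => z.shift ν)^[s + 1] x, ν⟩ : Matrix.specialUnitaryGroup n ℂ) : Matrix n n ℂ)
                * f ((fun z : Site P j => z.shift ν)^[s + 1 + 1] x)
                * star ((V ⟨(fun z : Site P j => z.shift ν)^[s + 1] x, ν⟩ : Matrix.specialUnitaryGroup n ℂ) : Matrix n n ℂ)
              - f ((fun z : Site P j => z.shift ν)^[s + 1] x))
            * star ((holAt V (walk x (List.replicate (s + 1) (ν, true))) : Matrix.specialUnitaryGroup n ℂ) : Matrix n n ℂ)
          = ((V ⟨x, ν⟩ : Matrix.specialUnitaryGroup n ℂ) : Matrix n n ℂ)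
            * (((holAt V (walk (x.shift ν) (List.replicate s (ν, true))) : Matrix.specialUnitaryGroup n ℂ) : Matrix n n ℂ)
              * (((V ⟨(fun z : Site P j => z.shift ν)^[s] (x.shift ν), ν⟩ : Matrix.specialUnitaryGroup n ℂ) : Matrix n n ℂ)
                  * f ((fun z : Site P j => z.shift ν)^[s + 1] (x.shift ν))
                  * star ((V ⟨(fun z : Site P j => z.shift ν)^[s] (x.shift ν), ν⟩ : Matrix.specialUnitaryGroup n ℂ) : Matrix n n ℂ)
                - f ((fun z : Site P j => z.shift ν)^[s] (x.shift ν)))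
              * star ((holAt V (walk (x.shift ν) (List.replicate s (ν, true))) : Matrix.specialUnitaryGroup n ℂ) : Matrix n n ℂ))
            * star ((V ⟨x, ν⟩ : Matrix.specialUnitaryGroup n ℂ) : Matrix n n ℂ) := by
      intro s _
      rw [holAt_walk_replicate_succ, Submonoid.coe_mul, star_mul]
      simp only [Function.iterate_succ_apply]
      noncomm_ring
    rw [Finset.sum_congr rfl hterm, ← Finset.sum_mul, ← Finset.mul_sum, ← ih]
    have h0 : ((holAt V (walk x (List.replicate 0 (ν, true))) : Matrix.specialUnitaryGroup n ℂ) : Matrix n n ℂ) = 1 := by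
      simp [walk, holAt_nil]
    simp only [h0, one_mul, star_one, mul_one, Function.iterate_succ_apply, Function.iterate_zero_apply]
    noncomm_ring

/-- **NORM FORM**: `‖T_m·f(x_m)·T_m* − f(x)‖ ≤ Σ_{s<m} ‖V(x_s,ν)f(x_{s+1})V(x_s,ν)* − f(x_s)‖` (the prefix transports are isometries). [cite: Balaban1985RegularSpaces, (1.1) p.76] -/
theorem norm_conj_line_sub_le (V : GaugeField P j (Matrix.specialUnitaryGroup n ℂ)) (f : Site P j → Matrix n n ℂ) (ν : Fin P.d) (m : ℕ) (x : Site P j) :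
    ‖((holAt V (walk x (List.replicate m (ν, true))) : Matrix.specialUnitaryGroup n ℂ) : Matrix n n ℂ) * f ((fun z : Site P j => z.shift ν)^[m] x)
          * star ((holAt V (walk x (List.replicate m (ν, true))) : Matrix.specialUnitaryGroup n ℂ) : Matrix n n ℂ) - f x‖
      ≤ ∑ s ∈ range m, ‖((V ⟨(fun z : Site P j => z.shift ν)^[s] x, ν⟩ : Matrix.specialUnitaryGroup n ℂ) : Matrix n n ℂ)
            * f ((fun z : Site P j => z.shift ν)^[s + 1] x)
            * star ((V ⟨(fun z : Site P j => z.shift ν)^[s] x, ν⟩ : Matrix.specialUnitaryGroup n ℂ) : Matrix n n ℂ)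
          - f ((fun z : Site P j => z.shift ν)^[s] x)‖ := by
  rw [conj_line_telescope]
  refine (norm_sum_le _ _).trans (Finset.sum_le_sum fun s _ => ?_)
  exact norm_conj_su_le _ _

/-! ## §2 ★★ The transverse covariant derivative of the line-sum function -/

/-- The word «`e_ν` then `t` steps `e_μ`» and the word «`t` steps `e_μ` then `e_ν`» have the same net displacement. [folklore] -/
theorem netDisp_cons_replicate_eq (μ ν : Fin P.d) (t : ℕ) (κ : Fin P.d) :
    netDisp ((ν, true) :: List.replicate t (μ, true)) κ = netDisp (List.replicate t (μ, true) ++ [(ν, true)]) κ := by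
  rw [T4ReflectionCone.netDisp_append, netDisp_cons]
  have h1 : netDisp [((ν, true) : Letter P.d)] κ = (if ν = κ then (1 : ℤ) else 0) := by
    rw [netDisp_cons]; simp [netDisp]
  rw [h1]
  by_cases h : ν = κ
  · simp only [h, ↓reduceIte]; ring
  · simp only [if_neg h]; ring

/-- The `t`-fold shift commutes with a transverse unit shift. [folklore] -/
theorem iterate_shift_shift_comm (μ ν : Fin P.d) : ∀ (t : ℕ) (x : Site P j),
    (fun z : Site P j => z.shift μ)^[t] (x.shift ν) = ((fun z : Site P j => z.shift μ)^[t] x).shift ν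
  | 0, x => rfl
  | t + 1, x => by
    simp only [Function.iterate_succ_apply]
    rw [shift_shift_comm x ν μ, iterate_shift_shift_comm μ ν t (x.shift μ)]

/-- The holonomy of «`t` steps `e_μ` then `e_ν`» from `x` is `V([x → t e_μ])·V(x + te_μ, ν)`. [folklore] -/
theorem holAt_walk_replicate_append_single (V : GaugeField P j (Matrix.specialUnitaryGroup n ℂ)) (x : Site P j) (μ ν : Fin P.d) (t : ℕ) :
    holAt V (walk x (List.replicate t (μ, true) ++ [(ν, true)]))
      = holAt V (walk x (List.replicate t (μ, true))) * V ⟨(fun z : Site P j => z.shift μ)^[t] x, ν⟩ := by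
  rw [walk_append, holAt_append]
  congr 1
  have hend : walkEnd x (List.replicate t (μ, true)) = (fun z : Site P j => z.shift μ)^[t] x := by
    induction t generalizing x with
    | zero => rfl
    | succ t ih =>
      rw [List.replicate_succ]
      show walkEnd (x.shift μ) (List.replicate t (μ, true)) = _
      rw [ih, Function.iterate_succ_apply]
  rw [hend]
  simp [walk, holAt_cons, holAt_nil]

/-- The holonomy of «`e_ν` then `t` steps `e_μ`» from `x` is `V(x,ν)·V([x + e_ν → t e_μ])`. [folklore] -/
theorem holAt_walk_cons_replicate (V : GaugeField P j (Matrix.specialUnitaryGroup n ℂ)) (x : Site P j) (μ ν : Fin P.d) (t : ℕ) :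
    holAt V (walk x ((ν, true) :: List.replicate t (μ, true))) = V ⟨x, ν⟩ * holAt V (walk (x.shift ν) (List.replicate t (μ, true))) := by
  rw [walk, holAt_cons]
  simp

/-- ★★ **THE TRANSVERSE COVARIANT DERIVATIVE OF THE LINE-SUM FUNCTION**: for `f(x) = Z_V([x → L steps e_μ])` (the covariant straight sum of brick 1 ∕ `LINE_V`),
under `PlaqSmall δ V`,
`‖V(x,ν)·f(x + e_ν)·V(x,ν)* − f(x)‖ ≤ Σ_{t<L} ‖(∇^V_ν Z)(x + te_μ, μ)‖ + 2L²δ·Σ_{t<L} ‖Z(x + e_ν + te_μ, μ)‖`,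
`(∇^V_ν Z)(b) = V(b₋,ν)Z(b + e_ν)V(b₋,ν)* − Z(b)`: term by term the two transports of `Z(x + e_ν + te_μ, μ)` back to `x` («`e_ν` first» vs «`e_μ`'s first») run along words
of equal net displacement and total length `2t + 2 ≤ 2L`, so differ by a loop within `((2t+2)²/4)δ ≤ L²δ` of `1` (`Prop7TwoWordStokes.norm_conj_holAt_sub_conj_holAt_le`).
[cite: Balaban1985RegularSpaces, (1.1) p.76; Balaban1985Averaging, (19)-(20) p.21] -/
theorem norm_covGrad_lineSum_le (V : GaugeField P j (Matrix.specialUnitaryGroup n ℂ)) {δ : ℝ} (hδ : 0 ≤ δ) (hV : PlaqSmall δ V)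
    (Z : PBond P j → Matrix n n ℂ) (μ ν : Fin P.d) (L : ℕ) (x : Site P j) :
    ‖((V ⟨x, ν⟩ : Matrix.specialUnitaryGroup n ℂ) : Matrix n n ℂ) * covWalkSum V Z (walk (x.shift ν) (List.replicate L (μ, true)))
          * star ((V ⟨x, ν⟩ : Matrix.specialUnitaryGroup n ℂ) : Matrix n n ℂ) - covWalkSum V Z (walk x (List.replicate L (μ, true)))‖
      ≤ ∑ t ∈ range L, ‖((V ⟨(fun z : Site P j => z.shift μ)^[t] x, ν⟩ : Matrix.specialUnitaryGroup n ℂ) : Matrix n n ℂ)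
            * Z ⟨((fun z : Site P j => z.shift μ)^[t] x).shift ν, μ⟩
            * star ((V ⟨(fun z : Site P j => z.shift μ)^[t] x, ν⟩ : Matrix.specialUnitaryGroup n ℂ) : Matrix n n ℂ)
          - Z ⟨(fun z : Site P j => z.shift μ)^[t] x, μ⟩‖
        + 2 * (L : ℝ) ^ 2 * δ * ∑ t ∈ range L, ‖Z ⟨((fun z : Site P j => z.shift μ)^[t] x).shift ν, μ⟩‖ := by
  rw [covWalkSum_walk_replicate_true, covWalkSum_walk_replicate_true, Finset.mul_sum, Finset.sum_mul, ← Finset.sum_sub_distrib]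
  refine (norm_sum_le _ _).trans ?_
  rw [Finset.mul_sum, ← Finset.sum_add_distrib]
  refine Finset.sum_le_sum fun t ht => ?_
  have htL : t < L := Finset.mem_range.mp ht
  -- names
  set xt : Site P j := (fun z : Site P j => z.shift μ)^[t] x with hxt
  have hx' : (fun z : Site P j => z.shift μ)^[t] (x.shift ν) = xt.shift ν := by rw [hxt, iterate_shift_shift_comm]
  rw [hx']
  set Xb : Matrix n n ℂ := Z ⟨xt.shift ν, μ⟩ with hXb
  -- the two transports of `Z(x + e_ν + te_μ)` back to `x`
  set W₁ : Matrix.specialUnitaryGroup n ℂ := holAt V (walk x ((ν, true) :: List.replicate t (μ, true))) with hW₁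
  set W₂ : Matrix.specialUnitaryGroup n ℂ := holAt V (walk x (List.replicate t (μ, true) ++ [(ν, true)])) with hW₂
  have hW₁' : W₁ = V ⟨x, ν⟩ * holAt V (walk (x.shift ν) (List.replicate t (μ, true))) := holAt_walk_cons_replicate V x μ ν t
  have hW₂' : W₂ = holAt V (walk x (List.replicate t (μ, true))) * V ⟨xt, ν⟩ := by rw [hW₂, holAt_walk_replicate_append_single]
  have hstokes := norm_conj_holAt_sub_conj_holAt_le V hδ hV x ((ν, true) :: List.replicate t (μ, true)) (List.replicate t (μ, true) ++ [(ν, true)])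
    (netDisp_cons_replicate_eq μ ν t) Xb
  rw [← hW₁, ← hW₂] at hstokes
  have hlen : ((((ν, true) :: List.replicate t (μ, true)).length + (List.replicate t (μ, true) ++ [(ν, true)]).length : ℕ) : ℝ) = 2 * t + 2 := by
    simp; ring
  rw [hlen] at hstokes
  -- split the term: (frame change) + (transported covariant derivative)
  set Ht : Matrix n n ℂ := ((holAt V (walk x (List.replicate t (μ, true))) : Matrix.specialUnitaryGroup n ℂ) : Matrix n n ℂ) with hHt
  set g : Matrix n n ℂ := ((V ⟨xt, ν⟩ : Matrix.specialUnitaryGroup n ℂ) : Matrix n n ℂ) with hg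
  have hsplit : ((V ⟨x, ν⟩ : Matrix.specialUnitaryGroup n ℂ) : Matrix n n ℂ)
          * (((holAt V (walk (x.shift ν) (List.replicate t (μ, true))) : Matrix.specialUnitaryGroup n ℂ) : Matrix n n ℂ) * Xb
              * star ((holAt V (walk (x.shift ν) (List.replicate t (μ, true))) : Matrix.specialUnitaryGroup n ℂ) : Matrix n n ℂ))
          * star ((V ⟨x, ν⟩ : Matrix.specialUnitaryGroup n ℂ) : Matrix n n ℂ)
        - Ht * Z ⟨xt, μ⟩ * star Ht
      = ((W₁ : Matrix.specialUnitaryGroup n ℂ) : Matrix n n ℂ) * Xb * star ((W₁ : Matrix.specialUnitaryGroup n ℂ) : Matrix n n ℂ)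
          - ((W₂ : Matrix.specialUnitaryGroup n ℂ) : Matrix n n ℂ) * Xb * star ((W₂ : Matrix.specialUnitaryGroup n ℂ) : Matrix n n ℂ)
        + Ht * (g * Xb * star g - Z ⟨xt, μ⟩) * star Ht := by
    rw [hW₁', hW₂', Submonoid.coe_mul, Submonoid.coe_mul, star_mul, star_mul]
    noncomm_ring
  rw [hsplit]
  refine (norm_add_le _ _).trans ?_
  have h2 : ‖Ht * (g * Xb * star g - Z ⟨xt, μ⟩) * star Ht‖ ≤ ‖g * Xb * star g - Z ⟨xt, μ⟩‖ := norm_conj_su_le _ _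
  have h1 : ‖((W₁ : Matrix.specialUnitaryGroup n ℂ) : Matrix n n ℂ) * Xb * star ((W₁ : Matrix.specialUnitaryGroup n ℂ) : Matrix n n ℂ)
        - ((W₂ : Matrix.specialUnitaryGroup n ℂ) : Matrix n n ℂ) * Xb * star ((W₂ : Matrix.specialUnitaryGroup n ℂ) : Matrix n n ℂ)‖
      ≤ 2 * (L : ℝ) ^ 2 * δ * ‖Xb‖ := by
    refine hstokes.trans ?_
    have ht1 : (2 * (t : ℝ) + 2) ^ 2 / 2 ≤ 2 * (L : ℝ) ^ 2 := by
      have : (t : ℝ) + 1 ≤ L := by exact_mod_cast htL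
      nlinarith
    have hX0 : 0 ≤ ‖Xb‖ := norm_nonneg _
    have := mul_le_mul_of_nonneg_right (mul_le_mul_of_nonneg_right ht1 hδ) hX0
    linarith
  linarith [h1, h2]

end Summit.QuantumFields.YangMills.Theorems.Prop7CovLineGradPointwise

end
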